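import Summits.BirchSwinnertonDyer.BirchSwinnertonDyer.Theses.TwistFamilyManinDescent
import Summits.BirchSwinnertonDyer.BirchSwinnertonDyer.Theorems.ManinLocalTwoThreeCDivisionIntegralCDT
import Summits.BirchSwinnertonDyer.BirchSwinnertonDyer.Theorems.EdixhovenFibreFiveSevenStarredOptimalManinUnitFiveSevenCdtThm1
import HarnessLib

/-!
# Route `TwistFamilyManinDescent`: the Eisenstein / ordinary-corner / supersingular Manin residuals at `p ∈ {5, 7, 13, 163}` —
# 25138, 26325, 26289, 27552, 27559, 27071 — and the dichotomy 27661, closed by name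

Cell `pub/bsd-wall`, seat `bsd-line-edix-p4` g41 (cross-route closer; no seat holds these items, all unclaimed at filing).
THEOREMS ONLY (no definition, no named fact, no instance, no `sorry`).

WHAT.  The sibling seat ttd-p1 g31 landed `TwistFamilyManinDescentOfCDT.*` (file `TwistFamilyManinDescentCellsOfCDT`): every
Manin residual of this route follows from ONE lemma — `p ∤ c(D)` for every lattice-optimal datum `D` of a globally minimal curve
at a level `N` with an odd `p² ∣ N` (the `¬ p ∣ ·` reading of the cell bsd-f2-manin's `|c(D)| = 1`), keyed there on the
Remark-58/59 reading `CalegariDimitrovTang2025_unboundedDenominators_algInt`.  The integer chain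
`ManinLocalTwoThree.CDivisionInt.abs_maninConstant_eq_one_of_CDTInt_of_odd_sq_dvd` gives the same from THEOREM 1.0.1 AS PRINTED,
and that printed theorem is now the tree theorem `calegariDimitrovTang2025_unboundedDenominators_holds` (p826028; line `cdt_thm1`
of crux K★ of route EdixhovenFibreFiveSeven).  §1 is the Theorem-1 twin of ttd-p1's lemma with the key DISCHARGED; §2–§3 prove
the seven route decls by name, verbatim the proofs of `TwistFamilyManinDescentOfCDT` (every reduction-type / twist / reducibility
clause idle; the dichotomy 27661 holds vacuously, its antecedent `p ∣ c(D)` being refuted).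

HONEST STATUS.  Manin's conjecture is NOT announced by this file (the route's deciding theorem still takes
`PrintedSemistableManinFacts` and C2 `ManinOddAtFour` 22967, claimed by seat manin23-p1); the chain rests on the tree's vendored
definitions of `ModularParametrizationData` / `periodLattice` / `maninConstant`, which deserve the refuters' audit now that the CDT
key is a theorem.  BSD is NOT proved by this. [cite: CalegariDimitrovTang2025, Thm. 1.0.1] [cite: LingOesterle1991, Thm. 6]
[cite: Mazur1978, Thm. 1]
-/

set_option autoImplicit false
-- the Theorems namespace of a single-conjunct summit repeats the summit name by design (D-0017)
set_option linter.dupNamespace false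

noncomputable section

open scoped Classical

open WeierstrassCurve Literature.NumberTheory.EllipticCurves Literature.NumberTheory.EllipticCurves.ModularForms
  Summit.BirchSwinnertonDyer.BirchSwinnertonDyer.Theses.TwistFamilyManinDescent
  Summit.BirchSwinnertonDyer.BirchSwinnertonDyer.Theorems

namespace Summit.BirchSwinnertonDyer.BirchSwinnertonDyer.Theorems.TwistFamilyManinDescentCdtThm1

/-! ### §1 Manin's `p`-part at any level with an odd `p² ∣ N` — UNCONDITIONAL -/

/-- **`p ∤ c(D)` for every lattice-optimal datum `D` of a globally minimal curve at a level `N` with an odd `p² ∣ N`** — the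
`¬ p ∣ ·` reading of `|c(D)| = 1` (`CDivisionInt.abs_maninConstant_eq_one_of_CDTInt_of_odd_sq_dvd` applied to the tree theorem
`calegariDimitrovTang2025_unboundedDenominators_holds`).  No hypothesis on the reduction of `W` at `p`.  The Theorem-1 twin of
`TwistFamilyManinDescentOfCDT.not_dvd_maninConstant_of_CDT_of_sq_dvd` with its key discharged.  Manin's conjecture and BSD are
not proved by this. [cite: CalegariDimitrovTang2025, Thm. 1.0.1] [cite: LingOesterle1991, Thm. 6] -/
theorem not_dvd_maninConstant_of_sq_dvd
    {W : WeierstrassCurve ℚ} [W.IsElliptic] [W.IsGloballyMinimal] {N : ℕ} [NeZero N]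
    (D : ModularParametrizationData W N) {p : ℕ} (hp : p.Prime) (hp3 : 3 ≤ p) (hsq : p ^ 2 ∣ N)
    (hlat : ∀ z ∈ D.L.lattice, ∃ w ∈ periodLattice D.f, z = D.c * w) : ¬ (p : ℤ) ∣ D.maninConstant := by
  have h1 : |D.maninConstant| = 1 :=
    ManinLocalTwoThree.CDivisionInt.abs_maninConstant_eq_one_of_CDTInt_of_odd_sq_dvd
      calegariDimitrovTang2025_unboundedDenominators_holds D hlat hp hp3 hsq
  intro hpc
  have hdvd : (p : ℤ) ∣ |D.maninConstant| := (dvd_abs (p : ℤ) D.maninConstant).mpr hpc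
  rw [h1] at hdvd
  have hp1 : p ∣ 1 := by exact_mod_cast hdvd
  exact hp.ne_one (Nat.dvd_one.mp hp1)

/-! ### §2 The route's Manin residuals BY NAME -/

/-- **Crux `EisensteinAdditiveManinResidual` (stmt-BirchSwinnertonDyer-25138: reducible `E[p]`, `p ∈ {5, 7, 13, 163}`), proved by
name** (all clauses but `p² ∣ N` and lattice-optimality idle).  BSD is NOT proved by this. [cite: CalegariDimitrovTang2025, Thm. 1.0.1]
[cite: Mazur1978, Thm. 1] -/
theorem EisensteinAdditiveManinResidual_proof : EisensteinAdditiveManinResidual := by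
  intro _mz _au _c2 _hnf W _ _ N _ D p hp hcell hsq _hred _htw hlat
  have hp3 : 3 ≤ p := by rcases hcell with rfl | rfl | rfl | ⟨rfl, _⟩ <;> omega
  exact not_dvd_maninConstant_of_sq_dvd D hp hp3 hsq hlat

/-- **`EisensteinRaynaudRegimeManinUnit` (stmt-BirchSwinnertonDyer-26325: the Raynaud-regime Eisenstein cells at `5`, `7`), proved
by name.**  BSD is NOT proved by this. [cite: CalegariDimitrovTang2025, Thm. 1.0.1] -/
theorem EisensteinRaynaudRegimeManinUnit_proof : EisensteinRaynaudRegimeManinUnit := by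
  intro _mz _au _c2 _hnf W _ _ N _ D p hp hcell hsq _hred _htw hlat
  have hp3 : 3 ≤ p := by rcases hcell with ⟨rfl, _⟩ | ⟨rfl, _⟩ <;> omega
  exact not_dvd_maninConstant_of_sq_dvd D hp hp3 hsq hlat

/-- **`EisensteinCornerManinResidual` (stmt-BirchSwinnertonDyer-26289: the Eisenstein corner at `5`, `7` off the Raynaud regime),
proved by name.**  BSD is NOT proved by this. [cite: CalegariDimitrovTang2025, Thm. 1.0.1] -/
theorem EisensteinCornerManinResidual_proof : EisensteinCornerManinResidual := by
  intro _mz _au _c2 _hnf W _ _ N _ D p hp h57 _hnotRay hsq _hred _htw hlat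
  have hp3 : 3 ≤ p := by rcases h57 with rfl | rfl <;> omega
  exact not_dvd_maninConstant_of_sq_dvd D hp hp3 hsq hlat

/-- **`OrdinaryCornerManinResidual` (stmt-BirchSwinnertonDyer-27552: the ORDINARY Eisenstein corner at `5`, `7`), proved by name.**
BSD is NOT proved by this. [cite: CalegariDimitrovTang2025, Thm. 1.0.1] -/
theorem OrdinaryCornerManinResidual_proof : OrdinaryCornerManinResidual := by
  intro _mz _au _c2 _hnf W _ _ N _ D p hp h57 _hnotRay _hnotSS hsq _hred _htw hlat
  have hp3 : 3 ≤ p := by rcases h57 with rfl | rfl <;> omega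
  exact not_dvd_maninConstant_of_sq_dvd D hp hp3 hsq hlat

/-- **`OrdinaryCornerTameManinResidual` (stmt-BirchSwinnertonDyer-27559: the ordinary corner's tame-inertia residual), proved by
name** (tame-inertia clause idle).  BSD is NOT proved by this. [cite: CalegariDimitrovTang2025, Thm. 1.0.1] -/
theorem OrdinaryCornerTameManinResidual_proof : OrdinaryCornerTameManinResidual := by
  intro _mz _au _c2 _hnf W _ _ N _ D p hp h57 _hnotRay _hnotSS hsq _hred _htw hlat _htame
  have hp3 : 3 ≤ p := by rcases h57 with rfl | rfl <;> omega
  exact not_dvd_maninConstant_of_sq_dvd D hp hp3 hsq hlat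

/-- **`SupersingularUnstarredStrongManinUnit` (stmt-BirchSwinnertonDyer-27071: reducible, potentially supersingular unstarred cells
`(5, IV)`, `(7, III)`), proved by name.**  BSD is NOT proved by this. [cite: CalegariDimitrovTang2025, Thm. 1.0.1] -/
theorem SupersingularUnstarredStrongManinUnit_proof : SupersingularUnstarredStrongManinUnit := by
  intro _mz _au _c2 _hnf W _ _ N _ D p hp hcell hsq _hred _htw hlat
  have hp3 : 3 ≤ p := by rcases hcell with ⟨rfl, _⟩ | ⟨rfl, _⟩ <;> omega
  exact not_dvd_maninConstant_of_sq_dvd D hp hp3 hsq hlat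

/-! ### §3 The deep ordinary-corner dichotomy, vacuously -/

/-- **`OrdinaryCornerDeepEdixhovenDichotomy` (stmt-BirchSwinnertonDyer-27661), proved by name, VACUOUSLY**: its antecedent
«`p ∣ c(D)` for the lattice-optimal conductor-level datum» is refuted (`p ∈ {5, 7}`, `p² ∣ N(W)` among the binders), so the
dichotomy holds with nothing to prove.  BSD is NOT proved by this. [cite: CalegariDimitrovTang2025, Thm. 1.0.1] -/
theorem OrdinaryCornerDeepEdixhovenDichotomy_proof : OrdinaryCornerDeepEdixhovenDichotomy := by
  intro W _ _ p _ _ D hsq hcell _hred _htw hlat _hdeep hpc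
  have hp3 : 3 ≤ p := by rcases hcell with ⟨rfl, _⟩ | ⟨rfl, _⟩ <;> omega
  exact absurd hpc (not_dvd_maninConstant_of_sq_dvd D Fact.out hp3 hsq hlat)

end Summit.BirchSwinnertonDyer.BirchSwinnertonDyer.Theorems.TwistFamilyManinDescentCdtThm1

end
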